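import Mathlib.FieldTheory.IsAlgClosed.Basic
import Literature.NumberTheory.Transcendental.ExpDominantSolvabilityProofs
import Summits.Schanuel.Schanuel.Theorems.ZilberDefs
import HarnessLib

/-!
# The bottom rung of the EAC ladder: `n = 1` (Marker 2006), certified from Brownawell–Masser

Every irreducible curve `V = W ∩ (ℂ × ℂˣ)` which is additively free (the `x`-coordinate is not
constant on `V`) meets the graph of `exp` — D. Marker, *A remark on Zilber's pseudoexponentiation*,
J. Symb. Logic 71 (2006); Aslanyan–Gallinaro arXiv:2409.12860 Thm 3.7. Here it is DERIVED in the
tree's vocabulary from the proved Brownawell–Masser theorem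
`Literature.NumberTheory.Transcendental.BrownawellMasser2017_dominantProjection_holds`: for `n = 1`,
additive freeness of `V` forces the additive projection to be dominant
(`hasDominantAddProjection_of_isAddFree_one`: a non-zero `p(x)` vanishing on `V` splits into
linear factors over `ℂ`, one of which lies in the prime ideal `I(W)`, making `x` constant on `V`).
Consequently every rung `EacOfProjDim 1 d` of `ZilberDefs.lean` holds (`eacOfProjDim_one`).
-/

noncomputable section

open MvPolynomial
open Literature.NumberTheory.Transcendental

set_option linter.dupNamespace false

namespace Summit.Schanuel.Schanuel.Theorems

/-- **Additively free curves have dominant additive projection** (`n = 1`): if `W ⊆ ℂ × ℂ` is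
irreducible Zariski closed, `V = W ∩ (ℂ × ℂˣ) ≠ ∅`, and `x` is not constant on `V`, then no
non-zero polynomial `p(x)` vanishes on `V`. [folklore] -/
theorem hasDominantAddProjection_of_isAddFree_one (W : Set (Fin 1 ⊕ Fin 1 → ℂ))
    (hW : IsIrreducibleClosed ℂ W) (hne : (W ∩ torusLocus ℂ 1).Nonempty)
    (hfree : IsAddFree ℂ 1 (W ∩ torusLocus ℂ 1)) :
    HasDominantAddProjection ℂ (W ∩ torusLocus ℂ 1) := by
  classical
  intro p hp
  by_contra hp0
  have hprime : (vanishingIdeal ℂ W).IsPrime := hW.2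
  set X0 : MvPolynomial (Fin 1 ⊕ Fin 1) ℂ := X (Sum.inl 0) with hX0
  set Y0 : MvPolynomial (Fin 1 ⊕ Fin 1) ℂ := X (Sum.inr 0) with hY0
  -- `p̃ = p(x)` as a polynomial in `(x, y)`
  set pt : MvPolynomial (Fin 1 ⊕ Fin 1) ℂ := rename Sum.inl p with hpt
  have hpt_eval : ∀ z : Fin 1 ⊕ Fin 1 → ℂ, aeval z pt = eval (projAdd z) p := by
    intro z
    rw [hpt, aeval_rename]
    rfl
  -- `p̃ · y ∈ I(W)`, hence `p̃ ∈ I(W)`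
  have hY0_not : Y0 ∉ vanishingIdeal ℂ W := by
    obtain ⟨z, hzW, hzT⟩ := hne
    intro h
    have := (mem_vanishingIdeal_iff.mp h) z hzW
    rw [hY0, aeval_X] at this
    exact hzT 0 this
  have hprod : pt * Y0 ∈ vanishingIdeal ℂ W := by
    rw [mem_vanishingIdeal_iff]
    intro z hzW
    rw [map_mul]
    by_cases hz0 : z (Sum.inr 0) = 0
    · rw [hY0, aeval_X, hz0, mul_zero]
    · have hzT : z ∈ torusLocus ℂ 1 := fun i => by
        have : i = 0 := Subsingleton.elim _ _
        rw [this]; exact hz0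
      rw [hpt_eval, hp z ⟨hzW, hzT⟩, zero_mul]
  have hpt_mem : pt ∈ vanishingIdeal ℂ W :=
    (hprime.mem_or_mem hprod).resolve_right hY0_not
  -- the univariate polynomial `P` with `p̃ = P(x)`
  set P : Polynomial ℂ := MvPolynomial.aeval (fun _ : Fin 1 => Polynomial.X) p with hP
  have hφP : Polynomial.aeval X0 P = pt := by
    rw [hP, ← AlgHom.comp_apply, MvPolynomial.comp_aeval, hpt]
    have hfun : (fun _ : Fin 1 => (Polynomial.aeval X0) (Polynomial.X : Polynomial ℂ)) =
        fun i : Fin 1 => (X (Sum.inl i) : MvPolynomial (Fin 1 ⊕ Fin 1) ℂ) := by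
      funext i
      rw [Polynomial.aeval_X, hX0, Subsingleton.elim i 0]
    rw [hfun, MvPolynomial.rename_eq_aeval]
    rfl
  have hP0 : P ≠ 0 := by
    intro h0
    apply hp0
    have : pt = 0 := by rw [← hφP, h0, map_zero]
    exact rename_injective _ Sum.inl_injective (by rw [← hpt, this, map_zero])
  -- `P` splits over `ℂ`: `P = lc · ∏ (X - a)`
  have hsplit := Polynomial.C_leadingCoeff_mul_prod_multiset_X_sub_C
    (IsAlgClosed.card_roots_eq_natDegree (p := P))
  have hmap : ((P.roots.map fun a => Polynomial.X - Polynomial.C a).map (Polynomial.aeval X0)) =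
      P.roots.map (fun a => X0 - C a) := by
    rw [Multiset.map_map]
    refine Multiset.map_congr rfl fun a _ => ?_
    simp only [Function.comp_apply, map_sub, Polynomial.aeval_X, Polynomial.aeval_C,
      MvPolynomial.algebraMap_eq]
  have hfactor : pt = C P.leadingCoeff * (P.roots.map fun a => X0 - C a).prod := by
    rw [← hφP]
    conv_lhs => rw [← hsplit]
    rw [map_mul, Polynomial.aeval_C, MvPolynomial.algebraMap_eq, map_multiset_prod, hmap]
  -- a linear factor lies in the prime `I(W)`
  have hlc : (C P.leadingCoeff : MvPolynomial (Fin 1 ⊕ Fin 1) ℂ) ∉ vanishingIdeal ℂ W := by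
    intro h
    have hunit : IsUnit (C P.leadingCoeff : MvPolynomial (Fin 1 ⊕ Fin 1) ℂ) :=
      (isUnit_iff_ne_zero.mpr (Polynomial.leadingCoeff_ne_zero.mpr hP0)).map C
    exact hprime.ne_top (Ideal.eq_top_of_isUnit_mem _ h hunit)
  rw [hfactor] at hpt_mem
  have hprodmem := (hprime.mem_or_mem hpt_mem).resolve_left hlc
  obtain ⟨f, hf, hfmem⟩ := (hprime.multiset_prod_mem_iff_exists_mem _).mp hprodmem
  obtain ⟨a, -, rfl⟩ := Multiset.mem_map.mp hf
  -- hence `x = a` on `W`, contradicting additive freeness of `V`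
  refine hfree (fun _ => 1) (fun h => by simpa using congr_fun h 0) ⟨a, fun z hz => ?_⟩
  have h1 := (mem_vanishingIdeal_iff.mp hfmem) z hz.1
  rw [map_sub, hX0, aeval_X, aeval_C] at h1
  simp only [Fin.sum_univ_one, Int.cast_one, one_mul]
  have : algebraMap ℂ ℂ a = a := rfl
  rw [this] at h1
  exact sub_eq_zero.mp h1

/-- **Marker's rung** (`n = 1`) of the EAC ladder, proved: for every `d`, `EacOfProjDim 1 d` — every
irreducible additively free curve `V ⊆ ℂ × ℂˣ` (rotundity and multiplicative freeness are not
needed) meets the graph of `exp`. Derived from the tree's Brownawell–Masser theorem via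
`hasDominantAddProjection_of_isAddFree_one`. Marker, J. Symb. Logic 71 (2006); Aslanyan–Gallinaro
arXiv:2409.12860 Thm 3.7. [cite: Marker2006, Thm (exp points on free curves); via BrownawellMasser2017 Prop. 2] -/
theorem eacOfProjDim_one (d : WithBot ℕ∞) : EacOfProjDim 1 d := by
  intro W hW hne _ hadd _ hdim _
  exact BrownawellMasser2017_dominantProjection_holds 1 W hW hdim
    (hasDominantAddProjection_of_isAddFree_one W hW hne hadd)

/-- The `n = 1` case of `IsExpAlgClosed ℂ` in its own vocabulary (no `EacOfProjDim` wrapper):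
irreducible closed `W ⊆ ℂ^{1⊕1}` of dimension `1` meeting the torus locus in an additively free set
meets `expGraph ℂ 1`. [cite: Marker2006, Thm (exp points on free curves); via BrownawellMasser2017 Prop. 2] -/
theorem inter_expGraph_nonempty_of_isAddFree_one (W : Set (Fin 1 ⊕ Fin 1 → ℂ))
    (hW : IsIrreducibleClosed ℂ W) (hne : (W ∩ torusLocus ℂ 1).Nonempty)
    (hadd : IsAddFree ℂ 1 (W ∩ torusLocus ℂ 1)) (hdim : zariskiDim ℂ W = 1) :
    (W ∩ expGraph ℂ 1).Nonempty :=
  BrownawellMasser2017_dominantProjection_holds 1 W hW (by exact_mod_cast hdim)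
    (hasDominantAddProjection_of_isAddFree_one W hW hne hadd)

end Summit.Schanuel.Schanuel.Theorems
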